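import Literature.AnabelianGeometry.EtaleTheta.Discharge.Sec3Cor38AllOfRankOnePoint
import Literature.AnabelianGeometry.EtaleTheta.Discharge.Sec3Cor38iiWeak
import Literature.AnabelianGeometry.EtaleTheta.Discharge.Sec3Cor38iiiOfIsFrobenioidWeak
import Literature.AnabelianGeometry.EtaleTheta.Discharge.Sec3Cor38Rows

/-!
# [EtTh] Corollary 3.8 — the SUB-PREDICATES of its printed proof AT THE RANK-ONE-POINT MODELS OF RECORD, for every `Cor38Hyp h`

S. Mochizuki, *The étale theta function and its Frobenioid-theoretic manifestations*, Publ. RIMS **45** (2009), Cor. 3.8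
(i)–(iii), statement PDF p. 80, proof pp. 81–82: "By applying [Mzk17], Theorem 3.4, (iv), in the case of assertion (i), and
[Mzk17], Theorem 3.4, (ii); [Mzk17], Corollary 4.11, (ii), in the case of assertion (ii), it follows that `Ψ` preserves the
submonoids '`O^▷(−)`' … pre-steps … linear morphisms … Frobenius-trivial objects" [cite: MochizukiEtTh2009, Cor 3.8 p.80–82].

abc-iut cell, D-0079 ORIGINAL-L / L-F [EtTh] (FACT rows F-2808 `StandardIsotropicNotGroupLike`, F-2809 `PreservesPreSteps` (conjunct),
F-2812 `PreservesOTri`, F-2813 `BaseSquare`, F-2814 `BaseSquareInv`, F-2815 `PreservesLinear` (conjunct), F-2819 `BsFldOfFactorisation`,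
F-2821 `PreservesFrobeniusTrivial`; cone nodes `EtTh:Cor3.8(i)`/`(ii)`), seat abc-iut-w6-d053 (gen 5), companion of the census
`LF-ETTH-S3.tsv`.  PROOF-ONLY (0 definitions, no instance, no new `Prop`): the Cor. 3.8 SUB-PREDICATES of abc-iut-L2-t3's
`Cor38Hyp` — whose universal closures are REFUTED as schemas (FACT-LIST) and whose conditional closers over the WEAK monoid
vocabulary take only `IsFrobenioid C_i` (+ Div-slimness of `D_i`) (abc-iut-w6-d040 / abc-iut-L2-d2 lineage,
`Discharge/Sec3Cor38iiWeak.lean`, `Sec3Cor38iiiOfIsFrobenioidWeak.lean`, `Sec3Cor38Rows.lean`) — HOLD with NO hypothesis beyond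
the Cor. 3.8 datum `h` at abc-iut-w6-d048's rank-one-point tempered Frobenioids `TemperedFrobenioid.ofRankOnePoint hZ P hpf R S`
(hence at the MODEL OF RECORD `TateTowerFrd.temperedFrobenioid` and at `OneCompFrd.temperedFrobenioidWeak`), because there
`IsFrobenioid` is the theorem `isFrobenioid_ofRankOnePoint` ([FrdI] Thm. 5.2 (ii) at the model) and the one-object base
`Discrete PUnit` is Div-slim (abc-iut-w6-d040's `Toy.isDivSlim45iv_discretePUnit`).  Everything consumed BY NAME; nothing landed
is edited or restated.  Complements abc-iut-L2-d2's `Sec3Cor38AllOfRankOnePoint.lean` (p451331: the three HEADS Cor38_i/ii/iii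
there) with the sub-predicate heads the L-F book lists separately.
HONEST FRAMING: instantiation certificates at semi-synthetic models of record (each lives over ONE point of `D₀`); the bare
schemas stay refuted; refereed pre-IUT material; nothing here bears on [IUTchIII] Cor. 3.12; no side taken; typed ≠ proved.
-/

noncomputable section

namespace Literature.AnabelianGeometry.EtaleTheta

open CategoryTheory Opposite Function Literature.AlgebraicGeometry.Frobenioids
  Literature.AnabelianGeometry.SemiGraphs LogDivisorModel LogDivisorModel.GaloisAction

namespace TemperedFrobenioid

section RankOnePair

variable {Z : LogDivisorModel.{0}} {G : Type} [Group G] {A : Z.GaloisAction G} (hZ : Z.CuspLaws) (P : RankOnePoint A)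
  (hpf : ∀ Y : ((isConnectedGSet (G := G)).FullSubcategory)ᵒᵖ,
    IsPerfFactorialCof ((DivisorMonoids.ofGaloisActionConnected A hZ).Φ₀.obj Y))
  (R S : ((Discrete PUnit.{1})ᵒᵖ ⥤ CommMonCat.{0}) → Prop)
  {Z' : LogDivisorModel.{0}} {G' : Type} [Group G'] {A' : Z'.GaloisAction G'} (hZ' : Z'.CuspLaws)
  (P' : RankOnePoint A')
  (hpf' : ∀ Y : ((isConnectedGSet (G := G')).FullSubcategory)ᵒᵖ,
    IsPerfFactorialCof ((DivisorMonoids.ofGaloisActionConnected A' hZ').Φ₀.obj Y))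
  (R' S' : ((Discrete PUnit.{1})ᵒᵖ ⥤ CommMonCat.{0}) → Prop)

/-- The one-object base `Discrete PUnit` of a rank-one-point tempered Frobenioid is Div-slim ([FrdI] Def. 4.5 (iv)) —
abc-iut-w6-d040's `Toy.isDivSlim45iv_discretePUnit` repackaged as L1's `PreFrobenioidData.IsDivSlim`.
[cite: MochizukiFrdI2008, Def. 4.5 (iv) p.86] -/
theorem isDivSlim_opsData_ofRankOnePoint : (ofRankOnePoint hZ P hpf R S).opsData.IsDivSlim :=
  ⟨fun _ _ _ => Iso.ext (NatTrans.ext (funext fun _ => Subsingleton.elim _ _))⟩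

variable (h : Cor38Hyp (ofRankOnePoint hZ P hpf R S) (ofRankOnePoint hZ' P' hpf' R' S'))

/-- **F-2808 `StandardIsotropicNotGroupLike` at the rank-one-point models, for every `h`** (indeed for every `Cor38Hyp` over the
weak monoid vocabulary: abc-iut-L2-d2's `standardIsotropicNotGroupLike_treeMonoidVocabWeak`). [cite: MochizukiEtTh2009, Cor 3.8 p.81] -/
theorem cor38Hyp_standardIsotropicNotGroupLike_ofRankOnePoint : h.StandardIsotropicNotGroupLike :=
  h.standardIsotropicNotGroupLike_treeMonoidVocabWeak

/-- **F-2813 `BaseSquare` at the rank-one-point models, for every `h`** ([FrdI] Cor. 4.11 (ii): the `1`-unique `Ψ^Base`),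
the bases being Div-slim. [cite: MochizukiEtTh2009, Cor 3.8 p.81] -/
theorem cor38Hyp_baseSquare_ofRankOnePoint : h.BaseSquare :=
  h.baseSquare_of_isFrobenioid_weak (isFrobenioid_ofRankOnePoint hZ P hpf R S) (isFrobenioid_ofRankOnePoint hZ' P' hpf' R' S')
    ⟨isDivSlim_opsData_ofRankOnePoint hZ P hpf R S, isDivSlim_opsData_ofRankOnePoint hZ' P' hpf' R' S'⟩

/-- **F-2814 `BaseSquareInv` at the rank-one-point models, for every `h`** (the `1`-unique `(Ψ⁻¹)^Base`).
[cite: MochizukiEtTh2009, Cor 3.8 p.81] -/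
theorem cor38Hyp_baseSquareInv_ofRankOnePoint : h.BaseSquareInv :=
  h.baseSquareInv_of_isFrobenioid_weak (isFrobenioid_ofRankOnePoint hZ P hpf R S)
    (isFrobenioid_ofRankOnePoint hZ' P' hpf' R' S')
    ⟨isDivSlim_opsData_ofRankOnePoint hZ P hpf R S, isDivSlim_opsData_ofRankOnePoint hZ' P' hpf' R' S'⟩

/-- **F-2812 `PreservesOTri` at the rank-one-point models, for every `h`** ("`Ψ` preserves the submonoids `O^▷(−)`", case (ii)
of C38-L04 EXACTLY AS PRINTED: Div-slim bases) — the bare schema being REFUTED at a non-slim datum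
(`OTriTwist.not_forall_preservesOTri`, p448239). [cite: MochizukiEtTh2009, Cor 3.8 p.81] -/
theorem cor38Hyp_preservesOTri_ofRankOnePoint : h.PreservesOTri :=
  h.preservesOTri_of_isFrobenioid_of_isDivSlim_weak (isFrobenioid_ofRankOnePoint hZ P hpf R S)
    (isFrobenioid_ofRankOnePoint hZ' P' hpf' R' S')
    ⟨isDivSlim_opsData_ofRankOnePoint hZ P hpf R S, isDivSlim_opsData_ofRankOnePoint hZ' P' hpf' R' S'⟩

/-- **F-2821 `PreservesFrobeniusTrivial` at the rank-one-point models, for every `h`** (p.82 l.1: "`Ψ` preserves … the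
Frobenius-trivial objects"). [cite: MochizukiEtTh2009, Cor 3.8 p.82] -/
theorem cor38Hyp_preservesFrobeniusTrivial_ofRankOnePoint : h.PreservesFrobeniusTrivial :=
  h.preservesFrobeniusTrivial_of_isFrobenioid_of_isDivSlim_weak (isFrobenioid_ofRankOnePoint hZ P hpf R S)
    (isFrobenioid_ofRankOnePoint hZ' P' hpf' R' S')
    ⟨isDivSlim_opsData_ofRankOnePoint hZ P hpf R S, isDivSlim_opsData_ofRankOnePoint hZ' P' hpf' R' S'⟩

/-- **F-2819 `BsFldOfFactorisation` at the rank-one-point models** (the base-field-theoretic part of a factorisation,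
[FrdI] Def. 1.3 (iv)(b) content) — abc-iut lineage's `bsFldOfFactorisation_of_isFrobenioid` with `IsFrobenioid` a theorem.
[cite: MochizukiEtTh2009, Cor 3.8 p.81] -/
theorem bsFldOfFactorisation_ofRankOnePoint : (ofRankOnePoint hZ P hpf R S).BsFldOfFactorisation :=
  (ofRankOnePoint hZ P hpf R S).bsFldOfFactorisation_of_isFrobenioid (isFrobenioid_ofRankOnePoint hZ P hpf R S)

/-- **The seven `h`-indexed sub-predicates together at the rank-one-point models, for every `h`, NO further hypothesis** — the rows
of the printed proof of Cor. 3.8 that precede its three heads (abc-iut-L2-d2's `cor38_ofRankOnePoint`, p451331).  Conjuncts 2–3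
(F-2809 `PreservesPreSteps` "`Ψ` preserves pre-steps", [FrdI] Thm. 3.4 (ii); F-2815 `PreservesLinear` "`Ψ` preserves linear
morphisms", Thm. 3.4 (iii)) are abc-iut-L2-d2's weak closers `preservesPreSteps_of_isFrobenioid_weak` /
`preservesLinear_of_isFrobenioid_weak` fed with `isFrobenioid_ofRankOnePoint` (their vocabulary-generic twins
`Cor38Hyp.preservesPreSteps_treeCatVocab_of_isMonoidOn` / `preservesLinear_treeCatVocab_of_isMonoidOn` are already landed, whence no
separate restatement here). [cite: MochizukiEtTh2009, Cor 3.8 p.81] -/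
theorem cor38Hyp_subPredicates_ofRankOnePoint :
    h.StandardIsotropicNotGroupLike ∧ h.PreservesPreSteps ∧ h.PreservesLinear ∧ h.BaseSquare ∧ h.BaseSquareInv ∧
      h.PreservesOTri ∧ h.PreservesFrobeniusTrivial :=
  ⟨cor38Hyp_standardIsotropicNotGroupLike_ofRankOnePoint hZ P hpf R S hZ' P' hpf' R' S' h,
    h.preservesPreSteps_of_isFrobenioid_weak (isFrobenioid_ofRankOnePoint hZ P hpf R S)
      (isFrobenioid_ofRankOnePoint hZ' P' hpf' R' S'),
    h.preservesLinear_of_isFrobenioid_weak (isFrobenioid_ofRankOnePoint hZ P hpf R S)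
      (isFrobenioid_ofRankOnePoint hZ' P' hpf' R' S'),
    cor38Hyp_baseSquare_ofRankOnePoint hZ P hpf R S hZ' P' hpf' R' S' h,
    cor38Hyp_baseSquareInv_ofRankOnePoint hZ P hpf R S hZ' P' hpf' R' S' h,
    cor38Hyp_preservesOTri_ofRankOnePoint hZ P hpf R S hZ' P' hpf' R' S' h,
    cor38Hyp_preservesFrobeniusTrivial_ofRankOnePoint hZ P hpf R S hZ' P' hpf' R' S' h⟩

end RankOnePair

end TemperedFrobenioid

/-! ## At the model of record: the Tate tower -/

namespace TateTowerFrd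

variable (R S R' S' : ((Discrete PUnit.{1})ᵒᵖ ⥤ CommMonCat.{0}) → Prop)
  (h : Cor38Hyp (temperedFrobenioid R S) (temperedFrobenioid R' S'))

/-- **The Cor. 3.8 sub-predicates F-2808 / F-2809 / F-2815 / F-2813 / F-2814 / F-2812 / F-2821 at the MODEL OF RECORD, for every
`h : Cor38Hyp` between two Tate-tower tempered Frobenioids — NO binder beyond `h`.** [cite: MochizukiEtTh2009, Cor 3.8 p.81] -/
theorem cor38Hyp_subPredicates_temperedFrobenioid :
    h.StandardIsotropicNotGroupLike ∧ h.PreservesPreSteps ∧ h.PreservesLinear ∧ h.BaseSquare ∧ h.BaseSquareInv ∧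
      h.PreservesOTri ∧ h.PreservesFrobeniusTrivial :=
  TemperedFrobenioid.cor38Hyp_subPredicates_ofRankOnePoint _ _ _ R S _ _ _ R' S' h

/-- F-2819 at the model of record. [cite: MochizukiEtTh2009, Cor 3.8 p.81] -/
theorem bsFldOfFactorisation_temperedFrobenioid : (temperedFrobenioid R S).BsFldOfFactorisation :=
  TemperedFrobenioid.bsFldOfFactorisation_ofRankOnePoint _ _ _ R S

/-- NON-VACUITY: the seven sub-predicates hold simultaneously for SOME `h` at the model of record (`Ψ := 𝟭`, abc-iut-w6-d052's
inhabitant `nonempty_cor38Hyp_ofRankOnePoint`). [cite: MochizukiEtTh2009, Cor 3.8 p.81] -/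
theorem exists_cor38Hyp_subPredicates_temperedFrobenioid :
    ∃ h : Cor38Hyp (temperedFrobenioid R S) (temperedFrobenioid R S),
      h.StandardIsotropicNotGroupLike ∧ h.PreservesPreSteps ∧ h.PreservesLinear ∧ h.BaseSquare ∧ h.BaseSquareInv ∧
        h.PreservesOTri ∧ h.PreservesFrobeniusTrivial := by
  obtain ⟨h⟩ := TemperedFrobenioid.nonempty_cor38Hyp_ofRankOnePoint TateTower.cuspLaws rankOnePoint hpf R S
  exact ⟨h, cor38Hyp_subPredicates_temperedFrobenioid R S R S h⟩

end TateTowerFrd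

end Literature.AnabelianGeometry.EtaleTheta

end
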